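import Literature.AlgebraicGeometry.AbelianSchemes.SerreTensorHomModule
import Literature.AlgebraicGeometry.AbelianSchemes.SerreTwistCoverOrientation
import Literature.AlgebraicGeometry.AbelianSchemes.IsogenyRoofTransportAlongIso
import HarnessLib

/-!
# The homomorphism `q : A₁ ⟶ A₂ ⊗_𝒪 𝔟` of a `𝔭`-FAMILY OF HOMOMORPHISMS `h : 𝔭 → Hom(A₁, A₂)` («`Hom(A₁, A₂ ⊗ 𝔭⁻¹) = Hom_𝒪(𝔭, Hom(A₁, A₂))`»)
# and the ISOGENY ROOF `A₁ —q→ A₂ ⊗_𝒪 𝔟 ←ψ_P— A₂` it spans ([Conrad2004GrossZagier] §7 Thm. 7.5; [RapoportSmithlingZhang2020Diagonal] §4.3 (4.23))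

Topic `AlgebraicGeometry/AbelianSchemes`, namespace `Literature.AlgebraicGeometry.AbelianSchemes.AbelianSchemeOver`.  THEOREMS ONLY (no definition, no named fact,
no `instance`, no notation, no `sorry`); §1–§2 over ANY base scheme `S` and any commutative coefficient ring `𝒪`, §3 over `Spec Ω`.  Cell `hodgecm-mathlib` (D-0151),
F0∕P6 «MOD», «GO 500» half A line L4∕L5 (X-LEAF socket `stub_EHECKE`, closer leaf `Lines/F0_P6a_StubEHECKE.lean` of LA5-plan (g3), organ stub `stub_ER1`):
**organ (O-B) «ROOF MIDDLE OVER `Ω` FROM A `𝔭`-FAMILY OF HOMS»** (LA5-plan (g3) 05:41:09Z (3); A-p06 (g35)); `--supports stmt-HodgeConjecture-24832`, count-neutral.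
HONEST LABEL: HC_CM is proved only modulo the 7 printed citations (2 remaining: hLiu418 = stmt-HodgeConjecture-24832, h413 = stmt-HodgeConjecture-24833) until
rung 0 closes; this file is generic and discharges none of them.

## Mathematics

`A₁, A₂ → S` abelian schemes with commutative group laws, `ι₂ : 𝒪 → End_S(A₂)` a ring action (★ `RingAction`), `ι₁ : 𝒪 → End_S(A₁)` any family of endomorphisms,
`𝔟 = E′·𝒪ᵐ` a Serre presentation (`E′² = E′`) with a column `P ∈ 𝔟` (`E′P = P`) whose coordinates `P_1, …, P_m` generate the ideal `𝔭` (model case: `𝔟 ≅ 𝔭⁻¹` for an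
invertible `𝔭`, `P ↔ 1`; ★ `Literature.NumberTheory.NumberFields.SerrePresentation`).  A **`𝔭`-FAMILY OF HOMOMORPHISMS** is a map `h : 𝔭 → Hom_S(A₁, A₂)` which is
`𝒪`-linear for the `𝒪`-module structure `x • f := f ≫ ι₂(x)` of `Hom(A₁, A₂)`: `h(π + π′) = h(π)·h(π′)`, `h(xπ) = h(π) ≫ ι₂(x)`, each `h(π)` a homomorphism (model case over
`ℂ`: `Aᵢ = V∕Λᵢ` with `𝔭Λ₁ ⊆ Λ₂` and `h(π) = π·𝟙_V`).  Since `Hom(A₁, A₂ ⊗_𝒪 𝔟) = {x ∈ Hom(A₁, A₂)ᵐ | E′x = x}` (★ `serreHomEquiv`, ★ `isMonHom_of_coords`) and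
`E′·(h(P_k))_k = (h((E′P)_j))_j = (h(P_j))_j` by linearity, THE FAMILY IS ONE HOMOMORPHISM

  **`q : A₁ ⟶ A₂ ⊗_𝒪 𝔟`, `q ≫ ι ≫ pr_k = h(P_k)`**   («`Hom_𝒪(𝔭, Hom(A₁, A₂)) = Hom(A₁, A₂) ⊗_𝒪 𝔭⁻¹ = Hom(A₁, A₂ ⊗_𝒪 𝔭⁻¹)`», [Conrad2004GrossZagier] §7 Thm. 7.5),

and with the ideal translation `ψ_P : A₂ ⟶ A₂ ⊗_𝒪 𝔟` («`A₂ → A₂ ⊗ 𝔭⁻¹`», ★ `serreTranslate`, coordinates `y ≫ ι₂(P_k)`) it satisfies, on `T`-points for every `S`-scheme `T`: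
(r0) `q ≫ ι_𝔟(π) = h(π) ≫ ψ_P` for `π ∈ 𝔭` (coordinates `h(P_k) ≫ ι₂(π) = h(π P_k) = h(π) ≫ ι₂(P_k)`) — «`d_π ∘ q = h_π`» in cover-free form;
(r1) `t ≫ q = 1 ↔ ∀ π ∈ 𝔭, t ≫ h(π) = 1` — **`Ker q = ⋂_{π ∈ 𝔭} Ker h(π)`** (model: `𝔭⁻¹Λ₂ ∕ Λ₁`);  (r2) `Ker ψ_P = A₂[𝔭]`, `ψ_P` surjective (★, recalled);
(r4) `ι₁(x) ≫ q = q ≫ ι_𝔟(x)` whenever `ι₁(x) ≫ h(P_k) = h(P_k) ≫ ι₂(x)`;  (r5) `σ₁ ≫ q = σ₂ ≫ ψ_P` whenever `σ₁ ≫ h(P_k) = σ₂ ≫ ι₂(P_k)` (level points correspond);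
(r3) over a reduced locally Noetherian base, for dual pairs `D₁, D₂, D_𝔟` (unit pins) and a `λ_𝔟 : A₂ ⊗ 𝔟 → (A₂ ⊗ 𝔟)^` EXACT FOR THE COVER, `ψ_P ≫ λ_𝔟 ≫ ψ_P^∨ = λ₂ ≫ [N]`
(★ `exists_isExactTwistPol_of_rosatiPair` supplies it; `N ∈ 𝔭 ∩ ℕ`, e.g. `N = p ∈ 𝔭_w`): **`q ≫ λ_𝔟 ≫ q^∨ = λ₁ ≫ [N]`** as soon as `h(N) ≫ λ₂ ≫ h(N)^∨ = λ₁ ≫ [N²]`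
(the one similitude law of the family at the integer `N`; proof: `q ≫ ι_𝔟(N) = h(N) ≫ ψ_P` by (r0), `ι_𝔟(N) = [N]`, `[N]^∨ = [N]` (★ `dualIsogenyOver_mulN`), so
`[N] ≫ (q ≫ λ_𝔟 ≫ q^∨) ≫ [N] = h(N) ≫ (λ₂ ≫ [N]) ≫ h(N)^∨ = λ₁ ≫ [N²] ≫ [N]`; cancel `[N²]` ★ `eq_of_comp_mulN_eq`).
Over `S = Spec Ω` this is EXACTLY an isogeny roof `A₁ —q→ B ←c— A₂`, `B := A₂ ⊗_𝒪 𝔟`, `c := ψ_P`, with the clauses (r1)–(r5) of the P6a reader `RoofΩ`∕`RoofAt` in the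
abstract-reader shape of ★ `roof_transport_along_iso` (§3) — [RapoportSmithlingZhang2020Diagonal] §4.3 (4.23) p. 21 (the Hecke correspondence at a split place through
`A ⊗ 𝔭⁻¹`), [Kottwitz1992] §5 pp. 389–391, [MumfordAV1970] §23 Thm. 2 (p. 231) ∕ §15 Thm. 1 (p. 143).  NO dual pair is constructed here: `D_𝔟`, its unit pin and `λ_𝔟` are
INPUTS, as in every ★ Serre file.

## Contents
* §1 `map_zero_eq_one_of_family`, `map_sum_eq_prod_of_family`, `comp_family_eq_one_of_forall` (bookkeeping of a `𝔭`-family), **`matrixComp_family_coords`** (`E′·(h P_k)_k = (h P_k)_k`),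
  **`exists_hom_coords_eq_family`** (the homomorphism `q`, with `IsMonHom`);
* §2 for ANY `q` with coordinates `h(P_k)`: `isMonHom_of_coords_eq_family`, **`comp_serreAction_i_eq_family_comp_serreTranslate`** (r0), **`comp_eq_one_iff_forall_family`** (r1),
  **`act_comp_eq_comp_serreAction_i_of_family`** (r4), **`comp_eq_comp_serreTranslate_of_family`** (r5), **`comp_lam_comp_dualIsogenyOver_eq_mulN_of_family`** (r3);
* §3 over `Spec Ω`: **`exists_roof_of_idealHomFamily`** — THE HEAD in `RoofAt` shape.

## References
* [Conrad2004GrossZagier] B. Conrad, *Gross–Zagier revisited*, MSRI Publ. 49 (2004), §7 (Thm. 7.5) (`Hom(M ⊗_𝒪 𝔐, N)`, `M ⊗_𝒪 𝔐` for projective `𝔐`).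
* [RapoportSmithlingZhang2020Diagonal] M. Rapoport, B. Smithling, W. Zhang, *Arithmetic diagonal cycles on unitary Shimura varieties*, Compositio Math. 156 (2020),
  §3.2 (p. 11), §4.3 (4.23) (p. 21).
* [Kottwitz1992] R. E. Kottwitz, *Points on some Shimura varieties over finite fields*, JAMS 5 (1992), §5 (pp. 389–391).
* [MumfordAV1970] D. Mumford, *Abelian Varieties* (1970), §15 Thm. 1 (p. 143), §23 Thm. 2 (p. 231).
* [MilneCM2006] J. S. Milne, *Complex Multiplication* (2006), §7 «𝔞-multiplications» (Def. 7.19–Rem. 7.23, pp. 58–59).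
* Tree: ★ `SerreTensorConstruction`, ★ `SerreTensorHomModule`, ★ `SerreTensorIdealTranslationKernel`, ★ `SerreTwistCoverOrientation`, ★ `DualIsogenyMulN`,
  ★ `IsogenyRoofTransportAlongIso`.
-/

noncomputable section

universe u

open CategoryTheory CategoryTheory.Limits AlgebraicGeometry MonoidalCategory CartesianMonoidalCategory
open scoped MonObj

-- Mathlib's `Over`/pull-back API is stated across semireducible wrappers (as in the ★ `AbelianSchemes/*` files).
set_option backward.isDefEq.respectTransparency false

namespace Literature.AlgebraicGeometry.AbelianSchemes

namespace AbelianSchemeOver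

open Literature.AlgebraicGeometry.Motives (AlgPoints)

/-! ## §1 A `𝔭`-family of homomorphisms is one homomorphism `q : A₁ ⟶ A₂ ⊗_𝒪 𝔟` -/

section Family

variable {S : Scheme.{u}} {A₁ A₂ : AbelianSchemeOver S} {O : Type*} [CommRing O] (act₂ : A₂.RingAction O) [IsCommMonObj A₂.X]
  (h : O → (A₁.X ⟶ A₂.X)) {𝔭 : Ideal O}

/-- A `𝔭`-family sends `0` to the unit homomorphism: `h 0 = 1` (from `h(0·0) = h 0 ≫ ι₂(0) = 1`). [cite: Conrad2004GrossZagier, §7 (Thm. 7.5)] -/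
theorem map_zero_eq_one_of_family (hlin : ∀ (x : O), ∀ π ∈ 𝔭, h (x * π) = h π ≫ act₂.i x) : h 0 = 1 := by
  have h0 := hlin 0 0 (Submodule.zero_mem 𝔭)
  rw [zero_mul] at h0
  rw [h0, act₂.i_zero, MonObj.comp_one]

/-- A `𝔭`-family turns sums inside `𝔭` into products: `h (∑ a_k) = ∏ h (a_k)`. [cite: Conrad2004GrossZagier, §7 (Thm. 7.5)] -/
theorem map_sum_eq_prod_of_family (hadd : ∀ π ∈ 𝔭, ∀ π' ∈ 𝔭, h (π + π') = h π * h π')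
    (hlin : ∀ (x : O), ∀ π ∈ 𝔭, h (x * π) = h π ≫ act₂.i x) {κ : Type*} (s : Finset κ) (a : κ → O) (ha : ∀ k ∈ s, a k ∈ 𝔭) :
    h (∑ k ∈ s, a k) = ∏ k ∈ s, h (a k) := by
  classical
  induction s using Finset.induction_on with
  | empty => rw [Finset.sum_empty, Finset.prod_empty, map_zero_eq_one_of_family act₂ h hlin]
  | insert b s hb ih =>
    rw [Finset.sum_insert hb, Finset.prod_insert hb,
      hadd _ (ha b (Finset.mem_insert_self b s)) _ (Ideal.sum_mem _ fun k hk => ha k (Finset.mem_insert_of_mem hk)),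
      ih fun k hk => ha k (Finset.mem_insert_of_mem hk)]

/-- **The annihilator of a point under a `𝔭`-family is checked on generators**: if the coordinates of `P` generate `𝔭` and `t ≫ h(P_k) = 1` for all `k`, then
`t ≫ h(π) = 1` for every `π ∈ 𝔭` (write `π = ∑ c_k P_k`, `h(π) = ∏ h(P_k) ≫ ι₂(c_k)`). [cite: MilneCM2006, §7] [cite: Conrad2004GrossZagier, §7 (Thm. 7.5)] -/
theorem comp_family_eq_one_of_forall {m : ℕ} (P : Matrix (Fin m) (Fin 1) O) (h𝔭 : Ideal.span (Set.range fun k => P k 0) = 𝔭)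
    (hadd : ∀ π ∈ 𝔭, ∀ π' ∈ 𝔭, h (π + π') = h π * h π') (hlin : ∀ (x : O), ∀ π ∈ 𝔭, h (x * π) = h π ≫ act₂.i x)
    {T : Over S} (t : T ⟶ A₁.X) (ht : ∀ k, t ≫ h (P k 0) = 1) {π : O} (hπ : π ∈ 𝔭) : t ≫ h π = 1 := by
  have hπ' : π ∈ Ideal.span (Set.range fun k => P k 0) := by rw [h𝔭]; exact hπ
  obtain ⟨c, hc⟩ := (Ideal.mem_span_range_iff_exists_fun (R := O)).mp hπ'
  have hPk : ∀ k, P k 0 ∈ 𝔭 := fun k => by rw [← h𝔭]; exact Ideal.subset_span ⟨k, rfl⟩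
  rw [← hc, map_sum_eq_prod_of_family act₂ h hadd hlin _ _ fun k _ => Ideal.mul_mem_left _ _ (hPk k), comp_finset_prod]
  refine Finset.prod_eq_one fun k _ => ?_
  haveI := act₂.isMonHom (c k)
  rw [hlin (c k) _ (hPk k), ← Category.assoc, ht k, MonObj.one_comp]

variable {m : ℕ} (E' : Matrix (Fin m) (Fin m) O) (hE' : E' * E' = E') (P : Matrix (Fin m) (Fin 1) O)

/-- **`E′·(h P_k)_k = (h P_k)_k`**: the tuple of values of a `𝔭`-family at the coordinates of `P ∈ 𝔟 = E′·𝒪ᵐ` is a point of `A₂ ⊗_𝒪 𝔟 = Fix([E′] ↷ A₂ᵐ)` with values in `A₁`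
(`(E′·x)_j = ∏_k h(P_k) ≫ ι₂(E′_{jk}) = h(∑_k E′_{jk} P_k) = h(P_j)`). [cite: Conrad2004GrossZagier, §7 (Thm. 7.5)] -/
theorem matrixComp_family_coords (hP : E' * P = P) (h𝔭 : Ideal.span (Set.range fun k => P k 0) = 𝔭)
    (hadd : ∀ π ∈ 𝔭, ∀ π' ∈ 𝔭, h (π + π') = h π * h π') (hlin : ∀ (x : O), ∀ π ∈ 𝔭, h (x * π) = h π ≫ act₂.i x) :
    matrixComp act₂ E' (fun k => h (P k 0)) = fun k => h (P k 0) := by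
  have hPk : ∀ k, P k 0 ∈ 𝔭 := fun k => by rw [← h𝔭]; exact Ideal.subset_span ⟨k, rfl⟩
  funext j
  unfold matrixComp
  have hj : P j 0 = ∑ k, E' j k * P k 0 := by
    conv_lhs => rw [← hP]
    rw [Matrix.mul_apply]
  rw [hj, map_sum_eq_prod_of_family act₂ h hadd hlin _ _ fun k _ => Ideal.mul_mem_left _ _ (hPk k)]
  exact Finset.prod_congr rfl fun k _ => (hlin (E' j k) _ (hPk k)).symm

/-- **THE HOMOMORPHISM OF A `𝔭`-FAMILY**: there is `q : A₁ ⟶ A₂ ⊗_𝒪 𝔟` with coordinates `q ≫ ι ≫ pr_k = h(P_k)`, and it is a homomorphism of `S`-group schemes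
(«`Hom_𝒪(𝔭, Hom(A₁, A₂)) = Hom(A₁, A₂ ⊗_𝒪 𝔭⁻¹)`»; `q := serreHomEquiv⁻¹ (h P_k)_k`, ★ `isMonHom_of_coords`). [cite: Conrad2004GrossZagier, §7 (Thm. 7.5)]
[cite: RapoportSmithlingZhang2020Diagonal, §3.2 (p. 11)] -/
theorem exists_hom_coords_eq_family (hP : E' * P = P) (h𝔭 : Ideal.span (Set.range fun k => P k 0) = 𝔭)
    (hadd : ∀ π ∈ 𝔭, ∀ π' ∈ 𝔭, h (π + π') = h π * h π') (hlin : ∀ (x : O), ∀ π ∈ 𝔭, h (x * π) = h π ≫ act₂.i x)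
    (hmon : ∀ k, IsMonHom (h (P k 0))) :
    ∃ (q : A₁.X ⟶ (serreTensor act₂ E' hE').X), IsMonHom q ∧
      ∀ k, (serreHomEquiv act₂ E' hE' A₁.X q : Fin m → (A₁.X ⟶ A₂.X)) k = h (P k 0) := by
  let q : A₁.X ⟶ (serreTensor act₂ E' hE').X :=
    (serreHomEquiv act₂ E' hE' A₁.X).symm ⟨fun k => h (P k 0), matrixComp_family_coords act₂ h E' P hP h𝔭 hadd hlin⟩
  have hq : ∀ k, (serreHomEquiv act₂ E' hE' A₁.X q : Fin m → (A₁.X ⟶ A₂.X)) k = h (P k 0) := fun k => by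
    simp only [q, Equiv.apply_symm_apply]
  exact ⟨q, isMonHom_of_coords (X := A₁) act₂ E' hE' q fun k => by rw [hq k]; exact hmon k, hq⟩

end Family

/-! ## §2 The rows (r0)(r1)(r4)(r5) of ANY `q` with coordinates `h(P_k)` -/

section Rows

variable {S : Scheme.{u}} {A₁ A₂ : AbelianSchemeOver S} {O : Type*} [CommRing O] (act₂ : A₂.RingAction O) [IsCommMonObj A₂.X]
  (h : O → (A₁.X ⟶ A₂.X)) {𝔭 : Ideal O} {m : ℕ} (E' : Matrix (Fin m) (Fin m) O) (hE' : E' * E' = E') (P : Matrix (Fin m) (Fin 1) O)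
  (q : A₁.X ⟶ (serreTensor act₂ E' hE').X) (hq : ∀ k, (serreHomEquiv act₂ E' hE' A₁.X q : Fin m → (A₁.X ⟶ A₂.X)) k = h (P k 0))

include hq in
/-- A `q` with homomorphism coordinates is a homomorphism (★ `isMonHom_of_coords`). [cite: Kottwitz1992, §5 (p. 390)] -/
theorem isMonHom_of_coords_eq_family (hmon : ∀ k, IsMonHom (h (P k 0))) : IsMonHom q :=
  isMonHom_of_coords (X := A₁) act₂ E' hE' q fun k => by rw [hq k]; exact hmon k

include hq in
/-- The coordinates of `t ≫ q` are `t ≫ h(P_k)`. [cite: Conrad2004GrossZagier, §7 (Thm. 7.5)] -/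
theorem serreHomEquiv_comp_of_coords_eq_family {T : Over S} (t : T ⟶ A₁.X) (k : Fin m) :
    (serreHomEquiv act₂ E' hE' T (t ≫ q) : Fin m → (T ⟶ A₂.X)) k = t ≫ h (P k 0) := by
  rw [serreHomEquiv_comp, hq]

include hq in
/-- **(r0) «`d_π ∘ q = h_π`» IN COVER-FREE FORM**: `q ≫ ι_𝔟(π) = h(π) ≫ ψ_P` for every `π ∈ 𝔭` (both sides have coordinates `h(π) ≫ ι₂(P_k) = h(P_k π) = h(P_k) ≫ ι₂(π)`).
[cite: Conrad2004GrossZagier, §7 (Thm. 7.5)] [cite: MilneCM2006, §7] -/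
theorem comp_serreAction_i_eq_family_comp_serreTranslate (hP : E' * P = P) (h𝔭 : Ideal.span (Set.range fun k => P k 0) = 𝔭)
    (hlin : ∀ (x : O), ∀ π ∈ 𝔭, h (x * π) = h π ≫ act₂.i x) {π : O} (hπ : π ∈ 𝔭) :
    q ≫ (serreAction act₂ E' hE').i π = h π ≫ serreTranslate act₂ E' hE' P := by
  have hPk : ∀ k, P k 0 ∈ 𝔭 := fun k => by rw [← h𝔭]; exact Ideal.subset_span ⟨k, rfl⟩
  refine (serreHomEquiv act₂ E' hE' A₁.X).injective (Subtype.ext (funext fun k => ?_))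
  rw [serreHomEquiv_comp_serreTranslate act₂ E' hE' P hP (h π) k, serreHomEquiv_apply_coe, Category.assoc, Category.assoc,
    serreAction_i_comp_ι_assoc, matrixEnd_scalar_powProj, ← Category.assoc, ← Category.assoc]
  have hk := hq k
  rw [serreHomEquiv_apply_coe] at hk
  rw [hk, ← hlin π _ (hPk k), ← hlin (P k 0) _ hπ, mul_comm]

include hq in
/-- **(r1) `Ker q = ⋂_{π ∈ 𝔭} Ker h(π)` ON `T`-POINTS**: `t ≫ q = 1 ↔ ∀ π ∈ 𝔭, t ≫ h(π) = 1` (coordinates of `t ≫ q` are `t ≫ h(P_k)`; a `𝔭`-family killing the generators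
`P_k` at `t` kills `𝔭` at `t`).  Model: `Ker(V∕Λ₁ → V∕𝔭⁻¹Λ₂) = {v | 𝔭v ⊆ Λ₂}`. [cite: Conrad2004GrossZagier, §7 (Thm. 7.5)] [cite: MilneCM2006, §7] -/
theorem comp_eq_one_iff_forall_family (h𝔭 : Ideal.span (Set.range fun k => P k 0) = 𝔭)
    (hadd : ∀ π ∈ 𝔭, ∀ π' ∈ 𝔭, h (π + π') = h π * h π') (hlin : ∀ (x : O), ∀ π ∈ 𝔭, h (x * π) = h π ≫ act₂.i x)
    {T : Over S} (t : T ⟶ A₁.X) : t ≫ q = 1 ↔ ∀ π ∈ 𝔭, t ≫ h π = 1 := by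
  rw [eq_one_iff_serreHomEquiv act₂ E' hE']
  simp only [serreHomEquiv_comp_of_coords_eq_family act₂ h E' hE' P q hq]
  refine ⟨fun ht π hπ => comp_family_eq_one_of_forall act₂ h P h𝔭 hadd hlin t ht hπ, fun ht k => ht _ ?_⟩
  rw [← h𝔭]; exact Ideal.subset_span ⟨k, rfl⟩

include hq in
/-- **(r4) EQUIVARIANCE THROUGH THE SERRE ACTION**: if `ι₁(x)` commutes past every `h(P_k)` into `ι₂(x)`, then `ι₁(x) ≫ q = q ≫ ι_𝔟(x)` (coordinates; ★ `serreAction_i_comp_ι`,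
★ `matrixEnd_scalar_powProj`). [cite: Kottwitz1992, §5 (p. 390)] -/
theorem act_comp_eq_comp_serreAction_i_of_family (act₁ : O → (A₁.X ⟶ A₁.X))
    (heq : ∀ (x : O) (k : Fin m), act₁ x ≫ h (P k 0) = h (P k 0) ≫ act₂.i x) (x : O) :
    act₁ x ≫ q = q ≫ (serreAction act₂ E' hE').i x := by
  haveI := (isMonHom_serreι_serreπ act₂ E' hE').2.2
  rw [← cancel_mono (serreι act₂ E' hE'), Category.assoc, Category.assoc, serreAction_i_comp_ι]
  refine pow_hom_ext fun k => ?_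
  have hk := hq k
  rw [serreHomEquiv_apply_coe, Category.assoc] at hk
  simp only [Category.assoc]
  rw [matrixEnd_scalar_powProj, hk, heq x k, ← hk, Category.assoc, Category.assoc]

include hq in
/-- **(r5) LEVEL POINTS CORRESPOND**: if `σ₁ ≫ h(P_k) = σ₂ ≫ ι₂(P_k)` for all `k` (the level law of the family; model: `π·(v∕n) + Λ₂ = ι₂(π)(v∕n + Λ₂)`), then
`σ₁ ≫ q = σ₂ ≫ ψ_P` (same coordinates). [cite: MumfordAV1970, §7 Thm. 4 (p. 72)] [cite: Kottwitz1992, §5 (p. 391)] -/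
theorem comp_eq_comp_serreTranslate_of_family (hP : E' * P = P) {T : Over S} (σ₁ : T ⟶ A₁.X) (σ₂ : T ⟶ A₂.X)
    (hlvl : ∀ k, σ₁ ≫ h (P k 0) = σ₂ ≫ act₂.i (P k 0)) :
    σ₁ ≫ q = σ₂ ≫ serreTranslate act₂ E' hE' P := by
  refine (serreHomEquiv act₂ E' hE' T).injective (Subtype.ext (funext fun k => ?_))
  rw [serreHomEquiv_comp_of_coords_eq_family act₂ h E' hE' P q hq, serreHomEquiv_comp_serreTranslate act₂ E' hE' P hP, hlvl]

end Rows

/-! ### §2b The polarisation row (r3) over a reduced locally Noetherian base -/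

section Lambda

variable {S : Scheme.{u}} [IsReduced S] [IsLocallyNoetherian S] {A₁ A₂ : AbelianSchemeOver S} {O : Type*} [CommRing O]
  (act₂ : A₂.RingAction O) [IsCommMonObj A₂.X]
  (h : O → (A₁.X ⟶ A₂.X)) {𝔭 : Ideal O} {m : ℕ} (E' : Matrix (Fin m) (Fin m) O) (hE' : E' * E' = E') (P : Matrix (Fin m) (Fin 1) O)
  (Q : Matrix (Fin 1) (Fin m) O) {N : ℕ}
  (q : A₁.X ⟶ (serreTensor act₂ E' hE').X) [IsMonHom q]
  (hq : ∀ k, (serreHomEquiv act₂ E' hE' A₁.X q : Fin m → (A₁.X ⟶ A₂.X)) k = h (P k 0))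
  (D₁ : A₁.DualPair) (D₂ : A₂.DualPair) (DB : (serreTensor act₂ E' hE').DualPair)
  (hD₁ : Nonempty ((Scheme.Modules.pullback (DualPair.unitHatSlice D₁)).obj D₁.P ≅ SheafOfModules.unit _))
  (hD₂ : Nonempty ((Scheme.Modules.pullback (DualPair.unitHatSlice D₂)).obj D₂.P ≅ SheafOfModules.unit _))
  (hDB : Nonempty ((Scheme.Modules.pullback (DualPair.unitHatSlice DB)).obj DB.P ≅ SheafOfModules.unit _))
  (lam₁ : A₁.X ⟶ D₁.hat.X) (lam₂ : A₂.X ⟶ D₂.hat.X) (lamB : (serreTensor act₂ E' hE').X ⟶ DB.hat.X) [IsMonHom lam₁] [IsMonHom lamB]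

/-- `N = QP ∈ 𝔭`: the Serre integer lies in the ideal generated by the coordinates of `P`. [cite: Conrad2004GrossZagier, §7 (Thm. 7.5)] -/
theorem natCast_mem_of_mul_eq_scalar (hQP : Q * P = Matrix.scalar (Fin 1) (N : O)) (h𝔭 : Ideal.span (Set.range fun k => P k 0) = 𝔭) :
    (N : O) ∈ 𝔭 := by
  have h1 : (N : O) = ∑ k, Q 0 k * P k 0 := by
    have := congrFun (congrFun hQP 0) 0
    rw [Matrix.mul_apply, Matrix.scalar_apply, Matrix.diagonal_apply_eq] at this
    exact this.symm
  rw [h1, ← h𝔭]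
  exact Ideal.sum_mem _ fun k _ => Ideal.mul_mem_left _ _ (Ideal.subset_span ⟨k, rfl⟩)

include hq hD₁ hD₂ hDB in
/-- **(r3) THE POLARISATION ROW `q ≫ λ_𝔟 ≫ q^∨ = λ₁ ≫ [N]`** from the cover relation `ψ_P ≫ λ_𝔟 ≫ ψ_P^∨ = λ₂ ≫ [N]` and the ONE similitude law of the family at the integer
`N ∈ 𝔭`: `h(N) ≫ λ₂ ≫ h(N)^∨ = λ₁ ≫ [N²]`.  Proof: `q ≫ ι_𝔟(N) = h(N) ≫ ψ_P` (r0), `ι_𝔟(N) = [N]` (★ `RingAction.i_natCast`), `[N]^∨ = [N]` (★ `dualIsogenyOver_mulN`),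
`(f ≫ g)^∨ = g^∨ ≫ f^∨` (★ `dualIsogenyOver_comp`), `[N]` central (★ `comp_mulN_eq_mulN_comp`); cancel `[N²]` (★ `eq_of_comp_mulN_eq`).
[cite: MumfordAV1970, §15 Thm. 1 (p. 143); §23 Thm. 2 (p. 231)] [cite: RapoportSmithlingZhang2020Diagonal, §4.3 (4.23) (p. 21)] -/
theorem comp_lam_comp_dualIsogenyOver_eq_mulN_of_family (hN : N ≠ 0) (hP : E' * P = P)
    (h𝔭 : Ideal.span (Set.range fun k => P k 0) = 𝔭) (hNmem : (N : O) ∈ 𝔭)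
    (hlin : ∀ (x : O), ∀ π ∈ 𝔭, h (x * π) = h π ≫ act₂.i x) [IsMonHom (h (N : O))]
    (hc3 : serreTranslate act₂ E' hE' P ≫ lamB ≫
        (haveI := isMonHom_serreTranslate act₂ E' hE' P; DualPair.dualIsogenyOver (serreTranslate act₂ E' hE' P) D₂ DB) =
      lam₂ ≫ D₂.hat.mulN N)
    (hsim : h (N : O) ≫ lam₂ ≫ DualPair.dualIsogenyOver (h (N : O)) D₁ D₂ = lam₁ ≫ D₁.hat.mulN (N ^ 2)) :
    q ≫ lamB ≫ DualPair.dualIsogenyOver q D₁ DB = lam₁ ≫ D₁.hat.mulN N := by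
  -- instances: `ψ_P`, the `[n]`'s and the dual homomorphisms are homomorphisms (reduced base)
  haveI := isMonHom_serreTranslate act₂ E' hE' P
  haveI : IsCommMonObj (serreTensor act₂ E' hE').X := isCommMonObj_serreTensor act₂ E' hE'
  haveI : IsCommMonObj D₁.hat.X := D₁.hat.isCommMonObj_of_isReduced_base
  haveI : IsCommMonObj D₂.hat.X := D₂.hat.isCommMonObj_of_isReduced_base
  haveI : IsCommMonObj DB.hat.X := DB.hat.isCommMonObj_of_isReduced_base
  haveI : ∀ n, IsMonHom ((serreTensor act₂ E' hE').mulN n) := fun n => (serreTensor act₂ E' hE').isMonHom_mulN n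
  haveI : ∀ n, IsMonHom (D₁.hat.mulN n) := fun n => D₁.hat.isMonHom_mulN n
  haveI : ∀ n, IsMonHom (D₂.hat.mulN n) := fun n => D₂.hat.isMonHom_mulN n
  haveI : ∀ n, IsMonHom (DB.hat.mulN n) := fun n => DB.hat.isMonHom_mulN n
  haveI := DualPair.isMonHom_dualIsogenyOver q D₁ DB hDB hD₁
  haveI := DualPair.isMonHom_dualIsogenyOver (h (N : O)) D₁ D₂ hD₂ hD₁
  haveI := DualPair.isMonHom_dualIsogenyOver (serreTranslate act₂ E' hE' P) D₂ DB hDB hD₂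
  -- (r0) at the integer `N ∈ 𝔭`: `q ≫ [N] = h(N) ≫ ψ_P`
  have h0 : q ≫ (serreTensor act₂ E' hE').mulN N = h (N : O) ≫ serreTranslate act₂ E' hE' P := by
    rw [mulN_def, ← (serreAction act₂ E' hE').i_natCast N]
    exact comp_serreAction_i_eq_family_comp_serreTranslate act₂ h E' hE' P q hq hP h𝔭 hlin hNmem
  -- `[a] ≫ [b] = [a·b]`
  have hmul : ∀ (X : AbelianSchemeOver S) (a b : ℕ), X.mulN a ≫ X.mulN b = X.mulN (a * b) := fun X a b => by
    rw [mulN_def, mulN_def, mulN_def, MonObj.comp_pow, Category.comp_id, ← pow_mul]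
  -- the pull-back of `λ_𝔟` along `q ≫ [N]`, computed through `h(N) ≫ ψ_P`
  have hA : (q ≫ (serreTensor act₂ E' hE').mulN N) ≫ lamB ≫
      DualPair.dualIsogenyOver (q ≫ (serreTensor act₂ E' hE').mulN N) D₁ DB = lam₁ ≫ D₁.hat.mulN (N ^ 2) ≫ D₁.hat.mulN N := by
    have hc : DualPair.dualIsogenyOver (q ≫ (serreTensor act₂ E' hE').mulN N) D₁ DB =
        DualPair.dualIsogenyOver (h (N : O) ≫ serreTranslate act₂ E' hE' P) D₁ DB := by
      have : ∀ {ψ₁ ψ₂ : A₁.X ⟶ (serreTensor act₂ E' hE').X} {h₁ : IsMonHom ψ₁} {h₂ : IsMonHom ψ₂} (_ : ψ₁ = ψ₂),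
          @DualPair.dualIsogenyOver _ _ _ ψ₁ h₁ D₁ DB = @DualPair.dualIsogenyOver _ _ _ ψ₂ h₂ D₁ DB := by
        intro ψ₁ ψ₂ h₁ h₂ e; subst e; rfl
      exact this h0
    rw [hc, h0, DualPair.dualIsogenyOver_comp (h (N : O)) (serreTranslate act₂ E' hE' P) D₁ D₂ DB]
    simp only [Category.assoc]
    rw [reassoc_of% hc3, ← comp_mulN_eq_mulN_comp (DualPair.dualIsogenyOver (h (N : O)) D₁ D₂) N, reassoc_of% hsim]
  -- … and computed through `[N]^∨ = [N]`
  have hB : (q ≫ (serreTensor act₂ E' hE').mulN N) ≫ lamB ≫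
      DualPair.dualIsogenyOver (q ≫ (serreTensor act₂ E' hE').mulN N) D₁ DB =
        (q ≫ lamB ≫ DualPair.dualIsogenyOver q D₁ DB) ≫ D₁.hat.mulN (N ^ 2) := by
    rw [DualPair.dualIsogenyOver_comp q ((serreTensor act₂ E' hE').mulN N) D₁ DB DB, DualPair.dualIsogenyOver_mulN DB hDB N]
    simp only [Category.assoc]
    rw [← Category.assoc ((serreTensor act₂ E' hE').mulN N) lamB, ← comp_mulN_eq_mulN_comp lamB N, Category.assoc,
      ← Category.assoc (DB.hat.mulN N) (DB.hat.mulN N), hmul, ← comp_mulN_eq_mulN_comp (DualPair.dualIsogenyOver q D₁ DB) (N * N), sq]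
  -- compare and cancel `[N²]`
  have hN2 : N ^ 2 ≠ 0 := pow_ne_zero 2 hN
  refine eq_of_comp_mulN_eq A₁ hN2 _ _ ?_
  rw [← hB, hA, Category.assoc, hmul, hmul, mul_comm]

end Lambda

/-! ## §3 Over `Spec Ω`: the isogeny roof `A₁ —q→ A₂ ⊗_𝒪 𝔟 ←ψ_P— A₂` in `RoofAt` shape -/

section Roof

variable {Ω : Type u} [Field Ω] {A₁ A₂ : AbelianSchemeOver (Spec (.of Ω))} {O : Type*} [CommRing O]
  (act₁ : O → (A₁.X ⟶ A₁.X)) (act₂ : A₂.RingAction O) [IsCommMonObj A₂.X]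
  (h : O → (A₁.X ⟶ A₂.X)) {𝔭 : Ideal O} {m : ℕ} (E' : Matrix (Fin m) (Fin m) O) (hE' : E' * E' = E') (P : Matrix (Fin m) (Fin 1) O)
  (Q : Matrix (Fin 1) (Fin m) O) {N : ℕ}
  (D₁ : A₁.DualPair) (D₂ : A₂.DualPair) (DB : (serreTensor act₂ E' hE').DualPair)
  (hD₁ : Nonempty ((Scheme.Modules.pullback (DualPair.unitHatSlice D₁)).obj D₁.P ≅ SheafOfModules.unit _))
  (hD₂ : Nonempty ((Scheme.Modules.pullback (DualPair.unitHatSlice D₂)).obj D₂.P ≅ SheafOfModules.unit _))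
  (hDB : Nonempty ((Scheme.Modules.pullback (DualPair.unitHatSlice DB)).obj DB.P ≅ SheafOfModules.unit _))
  (lam₁ : A₁.X ⟶ D₁.hat.X) (lam₂ : A₂.X ⟶ D₂.hat.X) (lamB : (serreTensor act₂ E' hE').X ⟶ DB.hat.X) [IsMonHom lam₁] [IsMonHom lamB]
  {J : Type*} (pt₁ : J → A₁.toAffine.toAbelianVariety.Points Ω) (pt₂ : J → A₂.toAffine.toAbelianVariety.Points Ω)
  (tors : A₂.toAffine.toAbelianVariety.Points Ω → Prop) (K : Subgroup (A₁.toAffine.toAbelianVariety.Points Ω))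

include hD₁ hD₂ hDB in
/-- **THE ISOGENY ROOF OF A `𝔭`-FAMILY OF HOMOMORPHISMS (organ (O-B) «ROOF MIDDLE OVER `Ω` FROM MARKED DATA»).**  Over `Spec Ω`, let `h : 𝔭 → Hom(A₁, A₂)` be a `𝔭`-family
(`hmon`, `hadd`, `hlin`) for a Serre presentation `(E′, P, Q, N)` of `𝔟 ≅ 𝔭⁻¹` (`hP hQ hQP hPQ`, `N ≠ 0`, `span {P_k} = 𝔭`), `ι₁`-equivariant (`heq`), with the similitude law at `N`
(`hsim`) and the level law on the chosen points (`hlvl`); let `D_𝔟` be a dual pair of `B := A₂ ⊗_𝒪 𝔟` with unit pin and `λ_𝔟` exact for the cover (`hc3`); let `K` be read by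
`P ∈ K ↔ ∀ π ∈ 𝔭, h(π) P = 1` and `tors` by `tors P ↔ ∀ a ∈ 𝔭, ι₂(a) P = 1`.  THEN `A₁ —q→ B ←ψ_P— A₂` is an isogeny roof with the clauses (r1)(r2)(surjective)(r3)(r3)(r4)(r5)
of the P6a reader `RoofΩ`∕`RoofAt`, in the abstract-reader shape of ★ `roof_transport_along_iso`. [cite: RapoportSmithlingZhang2020Diagonal, §4.3 (4.23) (p. 21)]
[cite: Kottwitz1992, §5 (pp. 389–391)] [cite: MumfordAV1970, §23 Thm. 2 (p. 231); §15 Thm. 1 (p. 143)] [cite: Conrad2004GrossZagier, §7 (Thm. 7.5)] -/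
theorem exists_roof_of_idealHomFamily (hN : N ≠ 0) (hP : E' * P = P) (hQ : Q * E' = Q)
    (hQP : Q * P = Matrix.scalar (Fin 1) (N : O)) (hPQ : P * Q = Matrix.scalar (Fin m) (N : O) * E')
    (h𝔭 : Ideal.span (Set.range fun k => P k 0) = 𝔭)
    (hmon : ∀ π ∈ 𝔭, IsMonHom (h π)) (hadd : ∀ π ∈ 𝔭, ∀ π' ∈ 𝔭, h (π + π') = h π * h π')
    (hlin : ∀ (x : O), ∀ π ∈ 𝔭, h (x * π) = h π ≫ act₂.i x)
    (heq : ∀ (x : O), ∀ π ∈ 𝔭, act₁ x ≫ h π = h π ≫ act₂.i x)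
    (hsim : haveI := hmon (N : O) (natCast_mem_of_mul_eq_scalar P Q hQP h𝔭);
      h (N : O) ≫ lam₂ ≫ DualPair.dualIsogenyOver (h (N : O)) D₁ D₂ = lam₁ ≫ D₁.hat.mulN (N ^ 2))
    (hc3 : serreTranslate act₂ E' hE' P ≫ lamB ≫
        (haveI := isMonHom_serreTranslate act₂ E' hE' P; DualPair.dualIsogenyOver (serreTranslate act₂ E' hE' P) D₂ DB) =
      lam₂ ≫ D₂.hat.mulN N)
    (hlvl : ∀ (i : J), ∀ π ∈ 𝔭, (AlgPoints.map (h π) (pt₁ i) : A₂.toAffine.toAbelianVariety.Points Ω) = AlgPoints.map (act₂.i π) (pt₂ i))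
    (hK : ∀ Pt, Pt ∈ K ↔ ∀ π ∈ 𝔭, (AlgPoints.map (h π) Pt : A₂.toAffine.toAbelianVariety.Points Ω) = 1)
    (htors : ∀ Pt, tors Pt ↔ ∀ a ∈ 𝔭, (AlgPoints.map (act₂.i a) Pt : A₂.toAffine.toAbelianVariety.Points Ω) = 1) :
    ∃ (B : AbelianSchemeOver (Spec (.of Ω))) (DB' : B.DualPair) (lamB' : B.X ⟶ DB'.hat.X) (_ : IsMonHom lamB')
        (_ : Nonempty ((Scheme.Modules.pullback DB'.unitHatSlice).obj DB'.P ≅ SheafOfModules.unit _))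
        (q : A₁.X ⟶ B.X) (_ : IsMonHom q) (c : A₂.X ⟶ B.X) (_ : IsMonHom c),
        (∀ Pt : A₁.toAffine.toAbelianVariety.Points Ω,
            (AlgPoints.map q Pt : B.toAffine.toAbelianVariety.Points Ω) = 1 ↔ Pt ∈ K) ∧
        (∀ Pt : A₂.toAffine.toAbelianVariety.Points Ω,
            (AlgPoints.map c Pt : B.toAffine.toAbelianVariety.Points Ω) = 1 ↔ tors Pt) ∧
        Function.Surjective c.left.base ∧
        q ≫ lamB' ≫ DualPair.dualIsogenyOver q D₁ DB' = lam₁ ≫ D₁.hat.mulN N ∧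
        c ≫ lamB' ≫ DualPair.dualIsogenyOver c D₂ DB' = lam₂ ≫ D₂.hat.mulN N ∧
        (∀ a : O, ∃ b : B.X ⟶ B.X, act₁ a ≫ q = q ≫ b ∧ act₂.i a ≫ c = c ≫ b) ∧
        (∀ i : J, (AlgPoints.map q (pt₁ i) : B.toAffine.toAbelianVariety.Points Ω) = AlgPoints.map c (pt₂ i)) := by
  have hPk : ∀ k, P k 0 ∈ 𝔭 := fun k => by rw [← h𝔭]; exact Ideal.subset_span ⟨k, rfl⟩
  have hNmem : (N : O) ∈ 𝔭 := natCast_mem_of_mul_eq_scalar P Q hQP h𝔭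
  -- the homomorphism of the family and the cover
  obtain ⟨q, hqmon, hq⟩ := exists_hom_coords_eq_family act₂ h E' hE' P hP h𝔭 hadd hlin fun k => hmon _ (hPk k)
  haveI := hqmon
  haveI := isMonHom_serreTranslate act₂ E' hE' P
  haveI := hmon (N : O) hNmem
  refine ⟨serreTensor act₂ E' hE', DB, lamB, inferInstance, hDB, q, hqmon, serreTranslate act₂ E' hE' P, inferInstance,
    fun Pt => ?_, fun Pt => ?_, (surjective_serreTranslate_left act₂ E' hE' P Q hN hP hQ hQP hPQ).1,
    comp_lam_comp_dualIsogenyOver_eq_mulN_of_family act₂ h E' hE' P q hq D₁ D₂ DB hD₁ hD₂ hDB lam₁ lam₂ lamB hN hP h𝔭 hNmem hlin hc3 hsim,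
    hc3, fun a => ?_, fun i => ?_⟩
  · -- (r1) the kernel of `q`
    rw [hK Pt]
    exact comp_eq_one_iff_forall_family act₂ h E' hE' P q hq h𝔭 hadd hlin Pt
  · -- (r2) the kernel of `ψ_P`
    rw [htors Pt]
    exact comp_serreTranslate_eq_one_iff_forall_mem act₂ E' hE' P hP h𝔭 Pt
  · -- (r4) equivariance through `ι_𝔟(a)`
    exact ⟨(serreAction act₂ E' hE').i a, act_comp_eq_comp_serreAction_i_of_family act₂ h E' hE' P q hq act₁ (fun x k => heq x _ (hPk k)) a,
      i_comp_serreTranslate act₂ E' hE' P hP a⟩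
  · -- (r5) the chosen points correspond
    exact comp_eq_comp_serreTranslate_of_family act₂ h E' hE' P q hq hP (pt₁ i) (pt₂ i) fun k => hlvl i _ (hPk k)

end Roof

end AbelianSchemeOver

end Literature.AlgebraicGeometry.AbelianSchemes

end
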